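import Literature.Analysis.FluidPDE.ESSLocalHolderHolds
import Summits.NavierStokesRegularity.NavierStokesRegularity.Theorems.CertifiedBlowupCertifiedBlowupAxisymBlowupBlowupSet
import HarnessLib

/-!
# Local `L³` blow-up at every blow-up point of a witness of the crux `CertifiedBlowupAxisymBlowup`

Theorems file landed `--supports stmt-NavierStokesRegularity-0727`, line `compact-amplification`
(continuation lead c4, wave 1, stub S6). For a witness of the crux — a maximal smooth solution
`(u, p)` of finite lifespan `T` of the unforced Navier–Stokes system (`ν > 0`), Leray–Hopf on
`[0, T]` from its rapidly decaying axisymmetric datum — the global `L³` blow-up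
`‖u(t)‖_{L³(ℝ³)} → ∞` (Seregin) is LOCALISED at the blow-up set
`Σ = {x₀ | ¬ IsBoundedNearTop u T x₀}`: at every `x₀ ∈ Σ` and EVERY scale `0 < r` (`r² < T`) the
`L^∞_t L³_x` norm of `u` over the parabolic cylinder `(T − r², T) × B(x₀, r)` is infinite
(`local_L3_blowup_of_not_isBoundedNearTop`, the registered stub). This is
Escauriaza–Seregin–Šverák's LOCAL theorem (ESS 2003, Thm. 1.4), a discharged tree theorem
(`ess_local_holder_holds`), run backwards at a top point `(T, x₀)`:
`isBoundedNearTop_of_setLIntegral_ball_le` rescales the witness about `(T, x₀)` by the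
viscosity-normalising parabolic map `Φ(s, y) = (T + (R²/ν) s, x₀ + R y)`, `v = (R/ν) u ∘ Φ`, at an
admissible scale `R ≤ r min(1, √ν)` (the template is c3's `exists_isBoundedNearTop_of_dissipation_le`
/ the tree's `axisymmetricL3_boundedNearTop_offAxis_of_seregin`: suitability of `(v, (R/ν)² q ∘ Φ)`
on `Q(0, 1)` for the gauged pressure `q`, the rescaled classical gradient as a weak gradient of
finite dissipation, `q ∘ Φ ∈ L^{3/2}(Q(0,1))`, the energy class), adds the transported bound
`ess sup_{-1<s<0} ∫_{B(0,1)} |v(s)|³ < ∞` (the critical `L³` norm is scale invariant), obtains from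
ESS Thm. 1.4 a Hölder continuous representative of `v` on the closure of `Q(0, 1/2)` — hence
`v ∈ L^∞(Q(0, 1/2))` — and transports the essential bound back to `u`
(`AxisymmetricL3Hyp.isBoundedNearTop_of_eLpNorm_rescaled_lt_top`). No new definitions, no
named-fact hypotheses, no `sorry`.

## References

* L. Escauriaza, G. Seregin, V. Šverák, *`L_{3,∞}`-solutions of Navier–Stokes equations and
  backward uniqueness*, Russ. Math. Surveys 58 (2003), Thm. 1.4. [EscauriazaSereginSverak2003]
* G. Seregin, *Lecture Notes on Regularity Theory for the Navier–Stokes Equations*, World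
  Scientific 2014, Ch. 6 §6.5 (pp. 129–131). [Seregin2014]
* G. Seregin, V. Šverák, Comm. PDE 34 (2009) = arXiv:0804.1803, §3. [SereginSverak2009]
-/

-- the summit and its single problem share the name (D-0017 nested layout)
set_option linter.dupNamespace false

noncomputable section

open MeasureTheory Set Function Filter Topology Metric
open scoped ENNReal NNReal

namespace Summit.NavierStokesRegularity.NavierStokesRegularity.Theorems.CertifiedBlowupAxisymBlowup.CompactAmplification

open Literature.Analysis Literature.Analysis.FluidPDE

section Witness

variable {ν T : ℝ} {u : ℝ → EuclideanSpace ℝ (Fin 3) → EuclideanSpace ℝ (Fin 3)}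
  {p : ℝ → EuclideanSpace ℝ (Fin 3) → ℝ}

/-- **Sliced bounds are transported by the parabolic rescaling.** If
`∫_{B(x₀, R)} ‖u(t)‖ₑⁿ ≤ C < ∞` for a.e. `t ∈ (T - β, T)`, then the rescaled field
`v = α u ∘ Φ`, `Φ(s, y) = (T + β s, x₀ + R y)`, satisfies `∫_{B(0, 1)} ‖v(s)‖ₑⁿ ≤ C₁` for a.e.
`s ∈ (-1, 0)`, with `C₁ = |α|ⁿ R⁻³ C < ∞` (change of variables in the slices). [folklore] -/
theorem exists_ae_setLIntegral_ball_rescaled_le (x₀ : EuclideanSpace ℝ (Fin 3)) {α β R : ℝ}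
    (hβ : 0 < β) (hR : 0 < R) (n : ℕ) {C : ℝ≥0∞} (hC : C ≠ ∞)
    (h : ∀ᵐ t ∂(volume.restrict (Ioo (T - β) T)), ∫⁻ x in ball x₀ R, ‖u t x‖ₑ ^ n ≤ C) :
    ∃ C₁ : ℝ≥0, ∀ᵐ s ∂(volume.restrict (Ioo (-1 : ℝ) 0)),
      ∫⁻ y in ball (0 : EuclideanSpace ℝ (Fin 3)) 1, ‖(α • stPull β R T x₀ u) s y‖ₑ ^ n ≤ C₁ := by
  have h' : ∀ᵐ t ∂(volume.restrict (Ioo (T + β * (-1)) (T + β * 0))),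
      ∫⁻ x in ball x₀ R, ‖u t x‖ₑ ^ n ≤ C := by
    rwa [mul_neg_one, mul_zero, add_zero, ← sub_eq_add_neg]
  have h2 := ae_sliced_setLIntegral_ball_stRescale hβ hR T x₀ x₀ R (-1) 0
    (fun t x => ‖u t x‖ₑ ^ n) h'
  rw [finrank_euclideanSpace_fin, sub_self, smul_zero, div_self hR.ne'] at h2
  set C₁ : ℝ≥0∞ := ‖α‖ₑ ^ n * (ENNReal.ofReal (R ^ 3)⁻¹ * C) with hC₁
  have hC₁top : C₁ ≠ ∞ :=
    ENNReal.mul_ne_top (by simp) (ENNReal.mul_ne_top ENNReal.ofReal_ne_top hC)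
  refine ⟨C₁.toNNReal, ?_⟩
  rw [ENNReal.coe_toNNReal hC₁top]
  filter_upwards [h2] with s hs
  have e : ∀ y : EuclideanSpace ℝ (Fin 3), ‖(α • stPull β R T x₀ u) s y‖ₑ ^ n =
      ‖α‖ₑ ^ n * ‖u (T + β * s) (x₀ + R • y)‖ₑ ^ n := by
    intro y
    rw [smul_stPull_apply, enorm_smul, mul_pow]
  simp only [e]
  rw [lintegral_const_mul' _ _ (by simp)]
  exact mul_le_mul' le_rfl hs

/-- **ESS's local theorem run backwards at a top point `(T, x₀)`, any `x₀`.** Under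
`AxisymmetricL3Hyp ν T u p`: if `∫_{B(x₀, r)} |u(t)|³ ≤ C` for all `t ∈ (T - r², T)` (`0 < r`),
then `u` is bounded on a backward parabolic neighbourhood of `(T, x₀)`. Rescale about `(T, x₀)` by
`α = R/ν`, `β = R²/ν`, `R = min(√T/(2κ), r min(1, √ν))`, `κ = 2 + 1/√ν`, to the unit-viscosity
pair `(v, π) = (α u ∘ Φ, α² q ∘ Φ)` on `Q(0, 1)` (`q` the gauged pressure): it is a distributional
solution there, `v ∈ L^{2,∞}(Q)` (energy inequality), the rescaled classical gradient is a weak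
gradient with `∫_Q |∇v|² < ∞`, `π ∈ L^{3/2}(Q)`, and `v ∈ L^{3,∞}(Q)` (the hypothesis, by scale
invariance of the sliced `L³` norm); ESS Thm. 1.4 (`ess_local_holder_holds`) gives a representative
Hölder continuous on the compact closure of `Q(0, 1/2)`, so `v ∈ L^∞(Q(0, 1/2))`, and the essential
bound is transported back to `u` (`isBoundedNearTop_of_eLpNorm_rescaled_lt_top`).
[cite: EscauriazaSereginSverak2003, Thm. 1.4] -/
theorem isBoundedNearTop_of_setLIntegral_ball_le (H : AxisymmetricL3Hyp ν T u p)
    (x₀ : EuclideanSpace ℝ (Fin 3)) {r C : ℝ} (hr : 0 < r)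
    (hC : ∀ t ∈ Ioo (T - r ^ 2) T, (∫⁻ x in ball x₀ r, ‖u t x‖ₑ ^ 3) ≤ ENNReal.ofReal C) :
    IsBoundedNearTop u T x₀ := by
  have hν := H.viscosity_pos
  have hT := H.time_pos
  set κ : ℝ := 2 + (Real.sqrt ν)⁻¹ with hκ
  have hκpos : 0 < κ := by positivity
  -- an admissible scale: `R κ ≤ √T / 2`, `R ≤ r`, `R² / ν ≤ r²`
  set R : ℝ := min (Real.sqrt T / (2 * κ)) (r * min 1 (Real.sqrt ν)) with hR
  have hRpos : 0 < R :=
    lt_min (by positivity) (mul_pos hr (lt_min one_pos (Real.sqrt_pos.2 hν)))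
  have hRκ : R * κ ≤ Real.sqrt T / 2 :=
    calc R * κ ≤ Real.sqrt T / (2 * κ) * κ :=
        mul_le_mul_of_nonneg_right (min_le_left _ _) hκpos.le
      _ = Real.sqrt T / 2 := by field_simp
  have hRr : R ≤ r :=
    calc R ≤ r * min 1 (Real.sqrt ν) := min_le_right _ _
      _ ≤ r * 1 := mul_le_mul_of_nonneg_left (min_le_left _ _) hr.le
      _ = r := mul_one r
  have hRν : R ^ 2 / ν ≤ r ^ 2 := by
    have h1 : R ≤ r * Real.sqrt ν :=
      (min_le_right _ _).trans (mul_le_mul_of_nonneg_left (min_le_right _ _) hr.le)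
    have h2 : R ^ 2 ≤ (r * Real.sqrt ν) ^ 2 := pow_le_pow_left₀ hRpos.le h1 2
    rw [mul_pow, Real.sq_sqrt hν.le] at h2
    rw [div_le_iff₀ hν]
    linarith
  set ρ : ℝ := R * κ with hρ
  have hρT : ρ ^ 2 ≤ T := by
    have h2 : ρ ^ 2 ≤ (Real.sqrt T / 2) ^ 2 := pow_le_pow_left₀ (by positivity) hRκ 2
    rw [div_pow, Real.sq_sqrt hT.le] at h2; linarith
  set α : ℝ := R / ν with hα
  set β : ℝ := R ^ 2 / ν with hβdef
  have hαpos : 0 < α := by positivity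
  have hβpos : 0 < β := by positivity
  have hβeq : β = α * R := by rw [hβdef, hα]; field_simp
  have hβρ : β ≤ ρ ^ 2 := by
    have h1 : β = (R * (Real.sqrt ν)⁻¹) ^ 2 := by
      rw [hβdef, mul_pow, inv_pow, Real.sq_sqrt hν.le, div_eq_mul_inv]
    rw [h1, hρ]
    have h2 : (Real.sqrt ν)⁻¹ ≤ κ := by rw [hκ]; linarith
    exact pow_le_pow_left₀ (by positivity) (mul_le_mul_of_nonneg_left h2 hRpos.le) 2
  have hRρ : R ≤ ρ :=
    le_mul_of_one_le_right hRpos.le (by rw [hκ]; linarith [inv_nonneg.2 (Real.sqrt_nonneg ν)])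
  have hβT : β ≤ T := hβρ.trans hρT
  -- the gauged pressure; the `ν`-cylinder `PO = (T - β, T) × B(x₀, R) ⊆ Q_ρ(T, x₀) ∩ slab`
  obtain ⟨q, hsuit, hqae, -⟩ := H.exists_gauged_pressure
  have hcylslab : parabolicCylinder ρ ((T : ℝ), x₀) ⊆ Ioo 0 T ×ˢ univ := by
    intro z hz
    rw [mem_parabolicCylinder] at hz
    exact ⟨⟨by nlinarith [hz.1.1], hz.1.2⟩, mem_univ _⟩
  set PO : TopologicalSpace.Opens (ℝ × EuclideanSpace ℝ (Fin 3)) :=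
    ⟨Ioo (T - β) T ×ˢ ball x₀ R, isOpen_Ioo.prod isOpen_ball⟩ with hPO
  have hPOcyl : (PO : Set (ℝ × EuclideanSpace ℝ (Fin 3))) ⊆ parabolicCylinder ρ ((T : ℝ), x₀) := by
    rintro ⟨t, x⟩ ⟨ht, hx⟩
    rw [mem_parabolicCylinder]
    refine ⟨⟨by linarith [ht.1], ht.2⟩, ?_⟩
    rw [mem_ball] at hx
    exact lt_of_lt_of_le hx hRρ
  have hPOslab : (PO : Set (ℝ × EuclideanSpace ℝ (Fin 3))) ⊆ Ioo 0 T ×ˢ univ :=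
    hPOcyl.trans hcylslab
  have hpre1 : stPreimage β R T x₀ PO = parabolicCylinderOpens 1 0 := by
    apply TopologicalSpace.Opens.ext
    rw [coe_stPreimage]
    have h := stAffine_preimage_cylinder_eq_parabolicCylinder hν hRpos T x₀ R
    rwa [div_self hRpos.ne'] at h
  have hQ1 : parabolicCylinder 1 (0 : ℝ × EuclideanSpace ℝ (Fin 3)) =
      stAffine β R T x₀ ⁻¹' (PO : Set (ℝ × EuclideanSpace ℝ (Fin 3))) := by
    rw [← coe_stPreimage, hpre1]; rfl
  -- the rescaled pair on `Q(0, 1) = Φ⁻¹(PO)`: suitable, unit viscosity, no force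
  have hsuit1 : IsSuitableWeakSolutionOn (parabolicCylinderOpens 1 0) 1 0
      (α • stPull β R T x₀ u) (α ^ 2 • stPull β R T x₀ q) := by
    have h0 := (hsuit PO hPOslab).stRescale hαpos hRpos hβeq T x₀
    have hvisc : α * ν / R = 1 := by rw [hα, div_mul_cancel₀ R hν.ne', div_self hRpos.ne']
    have hforce : ((α ^ 2 * R) • stPull β R T x₀
        (0 : ℝ → EuclideanSpace ℝ (Fin 3) → EuclideanSpace ℝ (Fin 3))) = 0 := by
      funext s y; simp [stPull]
    rwa [hvisc, hforce, hpre1] at h0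
  -- the rescaled classical gradient: a weak gradient of finite dissipation on `Q(0, 1)`
  have hGu : HasWeakSpatialGradientOn PO u fun t x => fderiv ℝ (u t) x :=
    hasWeakSpatialGradientOn_of_contDiffOn isOpen_Ioo hPOslab
      (H.classical_Ioo.smooth_velocity.of_le (by norm_cast))
  have hGv : HasWeakSpatialGradientOn (parabolicCylinderOpens 1 0)
      (α • stPull β R T x₀ u) ((α * R) • stPull β R T x₀ fun t x => fderiv ℝ (u t) x) := by
    rw [← hpre1]
    exact hGu.stRescale α hβpos hRpos T x₀
  have hGfin : ∫⁻ z in parabolicCylinder 1 (0 : ℝ × EuclideanSpace ℝ (Fin 3)),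
      ENNReal.ofReal (frobeniusNormSq
        (((α * R) • stPull β R T x₀ fun t x => fderiv ℝ (u t) x) z.1 z.2)) < ∞ := by
    rw [hQ1, setLIntegral_frobeniusNormSq_stRescale hβpos hRpos T x₀ (α * R)]
    refine ENNReal.mul_lt_top (ENNReal.mul_lt_top ENNReal.ofReal_lt_top ENNReal.ofReal_lt_top) ?_
    refine lt_of_le_of_lt (lintegral_mono_set ?_) H.lintegral_slab_frobeniusNormSq_fderiv_lt_top
    exact prod_mono (Ioo_subset_Ioo_left (by linarith)) (subset_univ _)
  -- `π ∈ L^{3/2}(Q(0, 1))`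
  have hq32 : ∫⁻ z in parabolicCylinder 1 (0 : ℝ × EuclideanSpace ℝ (Fin 3)),
      ‖(α ^ 2 • stPull β R T x₀ q) z.1 z.2‖ₑ ^ (3 / 2 : ℝ) < ∞ := by
    rw [hQ1, setLIntegral_enorm_rpow_stRescale hβpos hRpos T x₀ (α ^ 2) q _ (by norm_num)]
    refine ENNReal.mul_lt_top (ENNReal.mul_lt_top
      (ENNReal.rpow_lt_top_of_nonneg (by norm_num) enorm_ne_top) ENNReal.ofReal_lt_top) ?_
    exact lt_of_le_of_lt (lintegral_mono_set hPOcyl)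
      (H.lintegral_cylinder_gauged_pressure_lt_top hqae hρT x₀)
  -- `v ∈ L^{2,∞}(Q(0, 1))` from the energy inequality
  have hL2 : ∃ C₁ : ℝ≥0, ∀ᵐ s ∂(volume.restrict (Ioo (-1 : ℝ) 0)),
      ∫⁻ y in ball (0 : EuclideanSpace ℝ (Fin 3)) 1, ‖(α • stPull β R T x₀ u) s y‖ₑ ^ 2 ≤ C₁ := by
    refine exists_ae_setLIntegral_ball_rescaled_le x₀ hβpos hRpos 2 ENNReal.ofReal_ne_top
      (C := ENNReal.ofReal (2 * VectorCalculus.kineticEnergy (u 0))) ?_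
    refine (ae_restrict_mem measurableSet_Ioo).mono fun t ht => ?_
    have htI : t ∈ Ico 0 T := ⟨by linarith [ht.1], ht.2⟩
    exact (setLIntegral_le_lintegral _ _).trans (H.eEnergy_le htI)
  -- `v ∈ L^{3,∞}(Q(0, 1))`: the hypothesis, `(T - β, T) × B(x₀, R) ⊆ (T - r², T) × B(x₀, r)`
  have hL3 : ∃ C₁ : ℝ≥0, ∀ᵐ s ∂(volume.restrict (Ioo (-1 : ℝ) 0)),
      ∫⁻ y in ball (0 : EuclideanSpace ℝ (Fin 3)) 1, ‖(α • stPull β R T x₀ u) s y‖ₑ ^ 3 ≤ C₁ := by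
    refine exists_ae_setLIntegral_ball_rescaled_le x₀ hβpos hRpos 3 ENNReal.ofReal_ne_top
      (C := ENNReal.ofReal C) ?_
    refine (ae_restrict_mem measurableSet_Ioo).mono fun t ht => ?_
    have ht' : t ∈ Ioo (T - r ^ 2) T := ⟨by linarith [ht.1], ht.2⟩
    exact (lintegral_mono_set (ball_subset_ball hRr)).trans (hC t ht')
  -- ESS Thm. 1.4: a Hölder continuous representative on the closure of `Q(0, 1/2)`
  obtain ⟨w, Cw, γw, hγw, hw, hvw⟩ := ess_local_holder_holds _ _ hsuit1.distributional hL2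
    ⟨_, hGv, hGfin⟩ hq32 hL3
  have hK : IsCompact (closure (parabolicCylinder (1 / 2)
      ((0 : ℝ), (0 : EuclideanSpace ℝ (Fin 3))))) :=
    ((isBounded_Ioo _ _).prod isBounded_ball).isCompact_closure
  obtain ⟨M, hM⟩ := hK.exists_bound_of_continuousOn (hw.continuousOn hγw)
  have hbd : eLpNorm (uncurry (α • stPull β R T x₀ u)) ∞ (volume.restrict
      (parabolicCylinder (1 / 2) ((0 : ℝ), (0 : EuclideanSpace ℝ (Fin 3))))) < ∞ := by
    rw [eLpNorm_congr_ae hvw, eLpNorm_exponent_top]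
    refine (eLpNormEssSup_le_of_ae_bound (C := M) ?_).trans_lt ENNReal.ofReal_lt_top
    exact (ae_restrict_mem (isOpen_parabolicCylinder _ _).measurableSet).mono
      fun z hz => hM z (subset_closure hz)
  exact H.isBoundedNearTop_of_eLpNorm_rescaled_lt_top x₀ hαpos hβpos hRpos (by norm_num) hbd

end Witness

/-- **Local `L³` blow-up at every blow-up point and every scale** (registered stub of
stmt-NavierStokesRegularity-0727): for a maximal Leray–Hopf classical solution `(u, p)` of finite
lifespan `T` (`ν > 0`) from a rapidly decaying axisymmetric datum, at every blow-up point `x₀`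
(`¬ IsBoundedNearTop u T x₀`) and every scale `0 < r`, `r² < T`, the `L^∞_t L³_x` norm of `u`
over `(T - r², T) × B(x₀, r)` is infinite: no `C` bounds `∫_{B(x₀, r)} |u(t)|³` for all
`t ∈ (T - r², T)` (contrapositive of `isBoundedNearTop_of_setLIntegral_ball_le`, ESS 2003
Thm. 1.4 at the top point; maximality is not used). [cite: EscauriazaSereginSverak2003, Thm. 1.4] -/
theorem local_L3_blowup_of_not_isBoundedNearTop : ∀ {ν T : ℝ} {u : ℝ → EuclideanSpace ℝ (Fin 3) → EuclideanSpace ℝ (Fin 3)} {p : ℝ → EuclideanSpace ℝ (Fin 3) → ℝ}, 0 < ν → 0 < T → IsMaximalSmoothSolution ν 0 u p T → IsLerayHopfOn T ν 0 (u 0) u → HasRapidSpatialDecay (u 0) → IsAxisymmetric (u 0) → ∀ x₀ : EuclideanSpace ℝ (Fin 3), ¬ IsBoundedNearTop u T x₀ → ∀ r : ℝ, 0 < r → r ^ 2 < T → ¬ ∃ C : ℝ, ∀ t ∈ Set.Ioo (T - r ^ 2) T, (∫⁻ x in Metric.ball x₀ r, ‖u t x‖ₑ ^ 3) ≤ ENNReal.ofReal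 C := by
  intro ν T u p hν hT hmax hLH hdec haxi x₀ hx₀ r hr _
  rintro ⟨C, hC⟩
  exact hx₀ (isBoundedNearTop_of_setLIntegral_ball_le
    (axisymmetricL3Hyp_of_lerayHopf_classical hν hT hmax.1 hLH hdec haxi) x₀ hr hC)

end Summit.NavierStokesRegularity.NavierStokesRegularity.Theorems.CertifiedBlowupAxisymBlowup.CompactAmplification

end
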